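import Summits.ABC.ABC.Theorems.FeketeScalesScaleSubmultiplicativityNapIteration

/-!
# The NAP assembly: near-good propagation + sparse good scales ⟹ abc

Crux `stmt-ABC-2160`, decl `Summit.ABC.ABC.Theses.FeketeScales.ScaleSubmultiplicativity`, route
`FeketeScales` (ABC/ABC); lead c6 helper (`--supports`), part 2 of 2 answering the crux-strategist's
route-level finding R4 (`Cruxes/ScaleSubmultiplicativity/STRATEGY-CENSUS.md`, seat s1): the strategist's
statement `NapAssembly : NAP → SparseGoodScales → ABC` (companion `StrategistS1.lean`, stated with a
sketch, "est. 300–450 lines, provable now") is PROVED here as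
`ScaleSubmultiplicativity.abc_of_nap_of_sparseGoodScales`, with NAP written G-free (`Good` inlined).
Together with part 1's `nap_of_scaleSubmultiplicativity` (crux → NAP) this makes R4's re-cut — replace
the rank-2 hypothesis `ScaleSubmultiplicativity` by NAP, which (unlike the crux, stmt-ABC-2163) carries no
hypothesis-free polynomial-abc corollary (`StrategistS1.nearGoodPropagation_of_eventually_bad`) — ready
to file with its support item already a theorem.

## Proof (finitary Fekete lemma with ONE common exponent)

Fix `ε`; `ε' := min ε 1`, `M := ⌈4/ε'⌉`, `η := min (ε'/16) (δ₀/3)`.  Normalise NAP (`0 ≤ θ < 1`, `K = e^L`,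
`L ≥ 0`, thresholds `≥ 2`; `nap_normalise`).  Take a `(1+η)`-good scale `R` (SparseGoodScales) with
`t := log R` beyond the thresholds of `slack_le_linear`: `2M (L + t^θ)/t ≤ η` and
`L + 2^θ T^θ ≤ η (2 - 2^θ) T` for `T ≥ t`.
* `chain`: `Good (R^m) ((R^m)^{b₀})` for `1 ≤ m ≤ 2M + 1`, `b₀ := 1 + η + 2MΔ ≤ 1 + 2η`.
* `tower` from each base `R^m`: `Good ((R^m)^{2^i}) (((R^m)^{2^i})^{1+3η})` (`β ≤ η log R^m`).
* `cover`: a triple of radical `r` with `N := clog_R r ≥ M` lies below a tower scale `R^{m2^i}`,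
  `N ≤ m 2^i ≤ N + N/M`, so `log c ≤ (1+3η)(1+1/M)(log r + t) ≤ (1+ε') log r + B`
  (`(1+3η)(1+1/M) ≤ 1 + ε'` from `η ≤ ε'/16`, `1/M ≤ ε'/4`); radicals with `N < M` are bounded by the
  constant `(R^M)^{1+3η}`.
Every exponent used lies in `[1, 1+3η] ⊆ [1, 1+δ₀]`, so each NAP application is licit — the window
bookkeeping is the only difference from the crux's Assembly (which may combine arbitrary bounds and runs
the cheaper binary-digit scheme `allScales`).
-/

-- `Summit.<Summit>.<Problem>` is the mandated summit-side namespace (CONVENTIONS §2); for the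
-- single-conjunct summit `ABC` the two coincide, so the duplicate `ABC.ABC` is deliberate.
set_option linter.dupNamespace false

namespace Summit.ABC.ABC.Theorems

open Literature.NumberTheory.DiophantineGeometry


/-- **The NAP assembly** (crux-strategist s1, R4: `NapAssembly`, proved).  Near-good propagation in
some window `δ₀ > 0` together with `SparseGoodScales` implies the abc conjecture.  Proof: see the file
header — normalise, choose a `(1+η)`-good scale `R` beyond the two slack thresholds, run the chain
`R^m` (`m ≤ 2M+1`) and the towers `(R^m)^{2^i}` (`M ≤ m ≤ 2M`) at exponents in `[1, 1+3η] ⊆ [1, 1+δ₀]`,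
and cover every radical by a tower scale at most `(R^N)^{1+1/M}`. [folklore] -/
theorem ScaleSubmultiplicativity.abc_of_nap_of_sparseGoodScales :
    (∃ δ₀ : ℝ, 0 < δ₀ ∧ ∃ θ : ℝ, θ < 1 ∧ ∃ K : ℝ, 0 < K ∧ ∃ R₀ : ℕ, ∀ R₁ R₂ : ℕ,
      R₀ ≤ R₁ → R₀ ≤ R₂ → ∀ l : ℝ, 1 ≤ l → l ≤ 1 + δ₀ →
      (∀ a b c : ℕ, IsABCTriple a b c → rad a b c ≤ R₁ → (c : ℝ) ≤ (R₁ : ℝ) ^ l) →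
      (∀ a b c : ℕ, IsABCTriple a b c → rad a b c ≤ R₂ → (c : ℝ) ≤ (R₂ : ℝ) ^ l) →
      ∀ a b c : ℕ, IsABCTriple a b c → rad a b c ≤ R₁ * R₂ →
        (c : ℝ) ≤ K * Real.exp (Real.log ((R₁ : ℝ) * R₂) ^ θ) * ((R₁ : ℝ) * R₂) ^ l) →
    Summit.ABC.ABC.Theses.FeketeScales.SparseGoodScales → _root_.ABC := by
  intro hnap hgood
  rw [ABC_iff]
  intro ε hε
  obtain ⟨δ₀, hδ₀, θ₁, hθ₁, K, hK, R₀, hnap⟩ := hnap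
  -- the goodness predicate
  set P : ℕ → ℝ → Prop := fun S X => ∀ a b c : ℕ, IsABCTriple a b c → rad a b c ≤ S → (c : ℝ) ≤ X
    with hP_def
  have mono : ∀ S : ℕ, ∀ X Y : ℝ, P S X → X ≤ Y → P S Y :=
    fun S X Y hPX hXY a b c h1 h2 => (hPX a b c h1 h2).trans hXY
  -- normalised data
  set θ : ℝ := max θ₁ 0 with hθ_def
  have hθ0 : 0 ≤ θ := le_max_right _ _
  have hθ1 : θ < 1 := max_lt hθ₁ one_pos
  set L : ℝ := max (Real.log K) 0 with hL_def
  have hL : 0 ≤ L := le_max_right _ _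
  set R₀' : ℕ := max R₀ 2 with hR₀'_def
  have nap : ∀ S₁ S₂ : ℕ, R₀' ≤ S₁ → R₀' ≤ S₂ → ∀ l : ℝ, 1 ≤ l → l ≤ 1 + δ₀ →
      P S₁ ((S₁ : ℝ) ^ l) → P S₂ ((S₂ : ℝ) ^ l) →
      P (S₁ * S₂) (Real.exp L * Real.exp (Real.log ((S₁ : ℝ) * S₂) ^ θ) * ((S₁ : ℝ) * S₂) ^ l) :=
    NapAssembly.nap_normalise P hK mono
      (fun R₁ R₂ h₁ h₂ l hl₁ hl₂ g₁ g₂ => hnap R₁ R₂ h₁ h₂ l hl₁ hl₂ g₁ g₂)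
  -- parameters `ε' ≤ 1`, `M ≥ 4/ε'`, `η`
  set ε' : ℝ := min ε 1 with hε'_def
  have hε'0 : 0 < ε' := lt_min hε one_pos
  have hε'1 : ε' ≤ 1 := min_le_right _ _
  have hε'ε : ε' ≤ ε := min_le_left _ _
  set M : ℕ := ⌈4 / ε'⌉₊ with hM_def
  have hM4 : 4 / ε' ≤ (M : ℝ) := Nat.le_ceil _
  have hM4' : (4 : ℝ) ≤ 4 / ε' := by
    rw [le_div_iff₀ hε'0]; nlinarith
  have hMr1 : (1 : ℝ) ≤ (M : ℝ) := by linarith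
  have hM1 : 1 ≤ M := by exact_mod_cast hMr1
  have hMpos : (0 : ℝ) < (M : ℝ) := by linarith
  have hMinv : (M : ℝ)⁻¹ ≤ ε' / 4 := by
    rw [inv_le_comm₀ hMpos (by positivity)]
    calc (ε' / 4)⁻¹ = 4 / ε' := by rw [inv_div]
      _ ≤ M := hM4
  set η : ℝ := min (ε' / 16) (δ₀ / 3) with hη_def
  have hη0 : 0 < η := lt_min (by positivity) (by positivity)
  have hηε : η ≤ ε' / 16 := min_le_left _ _
  have hηδ : η ≤ δ₀ / 3 := min_le_right _ _
  -- constants attached to `θ`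
  have h2θ : (2 : ℝ) ^ θ < 2 := by
    have := Real.rpow_lt_rpow_of_exponent_lt (by norm_num : (1 : ℝ) < 2) hθ1
    rwa [Real.rpow_one] at this
  have h2θpos : 0 < (2 : ℝ) ^ θ := by positivity
  -- Step 1: the two slack thresholds
  obtain ⟨T₁, hT₁⟩ := NapAssembly.slack_le_linear (L := L) hθ0 hθ1 zero_le_one
    (κ := η / (2 * M)) (by positivity)
  obtain ⟨T₂, hT₂⟩ := NapAssembly.slack_le_linear (L := L) hθ0 hθ1 h2θpos.le
    (κ := η * (2 - (2 : ℝ) ^ θ)) (mul_pos hη0 (by linarith))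
  -- Step 2: a good scale `R ≥ R₀'` with `log R ≥ max T₁ T₂`
  obtain ⟨R, hRN, hR⟩ := hgood η hη0 (max R₀' ⌈Real.exp (max T₁ T₂)⌉₊)
  have hR₀R : R₀' ≤ R := (le_max_left _ _).trans hRN
  have hR₀R₀ : R₀ ≤ R₀' := le_max_left _ _
  have hR2 : 2 ≤ R := (le_max_right R₀ 2).trans hR₀R
  have hR1 : (1 : ℝ) < R := by exact_mod_cast hR2
  have hRpos : (0 : ℝ) < R := by positivity
  set t : ℝ := Real.log R with ht_def
  have ht : 0 < t := Real.log_pos hR1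
  have hTt : max T₁ T₂ ≤ t := by
    have h1 : Real.exp (max T₁ T₂) ≤ R :=
      (Nat.le_ceil _).trans (by exact_mod_cast (le_max_right _ _).trans hRN)
    have := Real.log_le_log (Real.exp_pos _) h1
    rwa [Real.log_exp] at this
  have hT₁t : T₁ ≤ t := (le_max_left _ _).trans hTt
  have hT₂t : T₂ ≤ t := (le_max_right _ _).trans hTt
  -- the seed: `R` is `(1+η)`-good
  have base : P R ((R : ℝ) ^ (1 + η)) := fun a b c habc hrad => hR a b c habc hrad
  -- Step 3: the chain up to `R^(2M+1)` at the uniform exponent `b₀ = 1 + η + 2M Δ ≤ 1 + 2η`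
  set Δ : ℝ := (L + t ^ θ) / t with hΔ_def
  have hΔ0 : 0 ≤ Δ := div_nonneg (by linarith [Real.rpow_nonneg ht.le θ]) ht.le
  have hΔ : (2 * M : ℕ) * Δ ≤ η := by
    have h1 := hT₁ t ht.le hT₁t
    rw [one_mul] at h1
    have h2 : Δ ≤ η / (2 * M) := by
      rw [hΔ_def, div_le_iff₀ ht]
      calc L + t ^ θ ≤ η / (2 * M) * t := h1
        _ = η / (2 * M) * t := rfl
    have h3 : ((2 * M : ℕ) : ℝ) = 2 * (M : ℝ) := by push_cast; ring
    rw [h3]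
    calc 2 * (M : ℝ) * Δ ≤ 2 * (M : ℝ) * (η / (2 * M)) :=
          mul_le_mul_of_nonneg_left h2 (by positivity)
      _ = η := by field_simp
  set b₀ : ℝ := 1 + η + ((2 * M : ℕ) : ℝ) * Δ with hb₀_def
  have hb₀1 : 1 ≤ b₀ := by
    have : 0 ≤ ((2 * M : ℕ) : ℝ) * Δ := mul_nonneg (Nat.cast_nonneg _) hΔ0
    rw [hb₀_def]; linarith
  have hb₀2 : b₀ ≤ 1 + 2 * η := by rw [hb₀_def]; linarith
  have hwin₁ : η + ((2 * M : ℕ) : ℝ) * ((L + Real.log R ^ θ) / Real.log R) ≤ δ₀ := by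
    rw [← ht_def, ← hΔ_def]; linarith
  have hchain := NapAssembly.chain P hθ1.le hL hη0.le hR₀R hR2 hwin₁ mono nap base
  -- `hchain k hk : P (R^(k+1)) (↑(R^(k+1)) ^ b₀)` for `k ≤ 2M`
  -- Step 4: towers from the bases `R^m`, `1 ≤ m ≤ 2M + 1`
  have htower : ∀ m : ℕ, 1 ≤ m → m ≤ 2 * M + 1 →
      ∀ i : ℕ, P ((R ^ m) ^ 2 ^ i) ((((R ^ m) ^ 2 ^ i : ℕ) : ℝ) ^ (1 + 3 * η)) := by
    intro m hm1 hm2 i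
    -- the base
    have hbase : P (R ^ m) (((R ^ m : ℕ) : ℝ) ^ b₀) := by
      obtain ⟨k, rfl⟩ : ∃ k, m = k + 1 := ⟨m - 1, by omega⟩
      exact hchain k (by omega)
    have hBR : R ≤ R ^ m := by
      calc R = R ^ 1 := (pow_one R).symm
        _ ≤ R ^ m := Nat.pow_le_pow_right (by omega) hm1
    have hB2 : 2 ≤ R ^ m := hR2.trans hBR
    have hBR₀ : R₀' ≤ R ^ m := hR₀R.trans hBR
    -- `T = log (R^m) = m t ≥ t`
    have hTB : Real.log ((R ^ m : ℕ) : ℝ) = (m : ℝ) * t := by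
      rw [Nat.cast_pow, Real.log_pow]
    have hm1r : (1 : ℝ) ≤ (m : ℝ) := by exact_mod_cast hm1
    have hTt' : t ≤ (m : ℝ) * t := le_mul_of_one_le_left ht.le hm1r
    have hTpos : 0 < (m : ℝ) * t := by positivity
    -- `β` with `L + 2^θ T^θ = β (2 - 2^θ)`, and `β ≤ η T`
    set T : ℝ := (m : ℝ) * t with hT_def
    set β : ℝ := (L + (2 : ℝ) ^ θ * T ^ θ) / (2 - (2 : ℝ) ^ θ) with hβ_def
    have h22 : 0 < 2 - (2 : ℝ) ^ θ := by linarith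
    have hβ0 : 0 ≤ β := div_nonneg (by positivity) h22.le
    have hβeq : L + (2 : ℝ) ^ θ * Real.log ((R ^ m : ℕ) : ℝ) ^ θ ≤ β * (2 - (2 : ℝ) ^ θ) := by
      rw [hTB, hβ_def, div_mul_cancel₀ _ h22.ne']
    have hβT : β ≤ η * T := by
      have h1 := hT₂ T hTpos.le (hT₂t.trans hTt')
      rw [hβ_def, div_le_iff₀ h22]
      linarith
    have hwin₂ : b₀ + β / Real.log ((R ^ m : ℕ) : ℝ) ≤ 1 + δ₀ := by
      rw [hTB]
      have : β / ((m : ℝ) * t) ≤ η := by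
        rw [div_le_iff₀ hTpos]; exact hβT
      linarith
    have h := NapAssembly.tower P hθ0 hθ1.le hL hβ0 hb₀1 hBR₀ hB2 hβeq hwin₂ mono nap hbase i
    refine mono _ _ _ h (Real.rpow_le_rpow_of_exponent_le ?_ ?_)
    · have : 1 ≤ (R ^ m) ^ 2 ^ i := Nat.one_le_pow _ _ (by positivity)
      exact_mod_cast this
    · rw [hTB]
      have : β / ((m : ℝ) * t) ≤ η := by
        rw [div_le_iff₀ hTpos]; exact hβT
      linarith
  -- Step 5: the constants and the covering
  set e : ℝ := 1 + 3 * η with he_def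
  have he1 : 1 ≤ e := by rw [he_def]; linarith
  have hcoef : e * (1 + (M : ℝ)⁻¹) ≤ 1 + ε' := by
    rw [he_def]
    have hu0 : 0 ≤ (M : ℝ)⁻¹ := inv_nonneg.mpr hMpos.le
    nlinarith [hMinv, hηε, hε'1, hη0.le, mul_le_mul hηε hMinv hu0 (by positivity : (0:ℝ) ≤ ε' / 16)]
  set C₀ : ℝ := ((R ^ M : ℕ) : ℝ) ^ e with hC₀_def
  have hC₀0 : 0 ≤ C₀ := Real.rpow_nonneg (Nat.cast_nonneg _) e
  set Bc : ℝ := e * (1 + (M : ℝ)⁻¹) * t with hBc_def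
  refine ⟨C₀ + Real.exp Bc + 1, by positivity, ?_⟩
  intro a b c habc
  set r : ℕ := rad a b c with hr_def
  have hr2 : 2 ≤ r := habc.two_le_rad
  have hr0 : 0 < r := by omega
  have hrpos : (0 : ℝ) < r := by exact_mod_cast hr0
  have hr1 : (1 : ℝ) ≤ r := by exact_mod_cast hr0
  set x : ℝ := Real.log r with hx_def
  have hx0 : 0 ≤ x := Real.log_nonneg hr1
  have hrpow1 : 1 ≤ (r : ℝ) ^ (1 + ε) := Real.one_le_rpow hr1 (by linarith)
  -- the least `N` with `r ≤ R^N`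
  set N : ℕ := Nat.clog R r with hN_def
  have hN1 : 1 ≤ N := Nat.clog_pos hR2 hr2
  have hrN : r ≤ R ^ N := Nat.le_pow_clog hR2 r
  have hlt : R ^ (N - 1) < r := by
    have := Nat.pow_pred_clog_lt_self hR2 (x := r) hr2
    simpa [Nat.pred_eq_sub_one] using this
  have hNt : (N : ℝ) * t < x + t := by
    have h1 : ((R : ℝ)) ^ (N - 1) < r := by exact_mod_cast hlt
    have h2 := Real.log_lt_log (pow_pos hRpos _) h1
    rw [Real.log_pow, Nat.cast_sub hN1] at h2
    push_cast at h2
    rw [← ht_def, ← hx_def] at h2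
    linarith
  by_cases hNM : N < M
  · -- small radical: `r ≤ R^M`, bounded by the chain at `m = M`
    have hrM : r ≤ R ^ M := hrN.trans (Nat.pow_le_pow_right (by omega) hNM.le)
    have hPM : P (R ^ M) (((R ^ M : ℕ) : ℝ) ^ e) := by
      have := htower M hM1 (by omega) 0
      simpa using this
    have hc : (c : ℝ) ≤ C₀ := hPM a b c habc hrM
    calc (c : ℝ) ≤ C₀ := hc
      _ ≤ C₀ * (r : ℝ) ^ (1 + ε) := le_mul_of_one_le_right hC₀0 hrpow1
      _ < (C₀ + Real.exp Bc + 1) * (r : ℝ) ^ (1 + ε) := by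
          apply mul_lt_mul_of_pos_right _ (by positivity)
          linarith [Real.exp_pos Bc]
  · -- large radical: cover `N` by `m 2^i`, `M ≤ m ≤ 2M`
    rw [not_lt] at hNM
    obtain ⟨m, i, hmM, hm2M, hNmi, hmiN⟩ := NapAssembly.cover hM1 hNM
    have hm1 : 1 ≤ m := hM1.trans hmM
    have hS : r ≤ (R ^ m) ^ 2 ^ i := by
      rw [← pow_mul]
      exact hrN.trans (Nat.pow_le_pow_right (by omega) hNmi)
    have hc : (c : ℝ) ≤ ((((R ^ m) ^ 2 ^ i : ℕ) : ℝ)) ^ e := htower m hm1 (by omega) i a b c habc hS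
    -- `log S = m 2^i t ≤ (1 + 1/M) N t < (1 + 1/M)(x + t)`
    have hSpos : (0 : ℝ) < (((R ^ m) ^ 2 ^ i : ℕ) : ℝ) := by positivity
    have hlogS : Real.log ((((R ^ m) ^ 2 ^ i : ℕ) : ℝ)) = ((m * 2 ^ i : ℕ) : ℝ) * t := by
      rw [← pow_mul, Nat.cast_pow, Real.log_pow]
    have hmi : ((m * 2 ^ i : ℕ) : ℝ) ≤ (1 + (M : ℝ)⁻¹) * N := by
      have h1 : ((m * 2 ^ i : ℕ) : ℝ) ≤ (N : ℝ) + ((N / M : ℕ) : ℝ) := by exact_mod_cast hmiN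
      have h2 : ((N / M : ℕ) : ℝ) ≤ (N : ℝ) / (M : ℝ) := Nat.cast_div_le
      rw [div_eq_mul_inv] at h2
      calc ((m * 2 ^ i : ℕ) : ℝ) ≤ (N : ℝ) + ((N / M : ℕ) : ℝ) := h1
        _ ≤ (N : ℝ) + (N : ℝ) * (M : ℝ)⁻¹ := by linarith
        _ = (1 + (M : ℝ)⁻¹) * N := by ring
    have hN0 : (0 : ℝ) ≤ N := Nat.cast_nonneg N
    have hlogS' : Real.log ((((R ^ m) ^ 2 ^ i : ℕ) : ℝ)) ≤ (1 + (M : ℝ)⁻¹) * (x + t) := by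
      rw [hlogS]
      have h1 : ((m * 2 ^ i : ℕ) : ℝ) * t ≤ (1 + (M : ℝ)⁻¹) * N * t :=
        mul_le_mul_of_nonneg_right hmi ht.le
      have h2 : (1 + (M : ℝ)⁻¹) * N * t ≤ (1 + (M : ℝ)⁻¹) * (x + t) := by
        have := mul_le_mul_of_nonneg_left hNt.le (by positivity : (0 : ℝ) ≤ 1 + (M : ℝ)⁻¹)
        calc (1 + (M : ℝ)⁻¹) * N * t = (1 + (M : ℝ)⁻¹) * ((N : ℝ) * t) := by ring
          _ ≤ (1 + (M : ℝ)⁻¹) * (x + t) := this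
      linarith
    have hexp : ((((R ^ m) ^ 2 ^ i : ℕ) : ℝ)) ^ e ≤ Real.exp Bc * (r : ℝ) ^ (1 + ε) := by
      rw [Real.rpow_def_of_pos hSpos, Real.rpow_def_of_pos hrpos, ← hx_def, ← Real.exp_add,
        Real.exp_le_exp]
      have h1 : Real.log ((((R ^ m) ^ 2 ^ i : ℕ) : ℝ)) * e ≤ (1 + (M : ℝ)⁻¹) * (x + t) * e :=
        mul_le_mul_of_nonneg_right hlogS' (by linarith)
      have h2 : (1 + (M : ℝ)⁻¹) * (x + t) * e = e * (1 + (M : ℝ)⁻¹) * x + Bc := by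
        rw [hBc_def]; ring
      have h3 : e * (1 + (M : ℝ)⁻¹) * x ≤ (1 + ε) * x :=
        mul_le_mul_of_nonneg_right (hcoef.trans (by linarith)) hx0
      calc Real.log ((((R ^ m) ^ 2 ^ i : ℕ) : ℝ)) * e ≤ (1 + (M : ℝ)⁻¹) * (x + t) * e := h1
        _ = e * (1 + (M : ℝ)⁻¹) * x + Bc := h2
        _ ≤ (1 + ε) * x + Bc := by linarith
        _ = Bc + x * (1 + ε) := by ring
    calc (c : ℝ) ≤ ((((R ^ m) ^ 2 ^ i : ℕ) : ℝ)) ^ e := hc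
      _ ≤ Real.exp Bc * (r : ℝ) ^ (1 + ε) := hexp
      _ < (C₀ + Real.exp Bc + 1) * (r : ℝ) ^ (1 + ε) := by
          apply mul_lt_mul_of_pos_right _ (by positivity)
          linarith

end Summit.ABC.ABC.Theorems
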